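import Summits.QuantumFields.YangMills.Theorems.BalabanUVNodesN19HybridChainRuleTower
import Summits.QuantumFields.YangMills.Theorems.BalabanUVNodesN19EventualBinderList
import Summits.QuantumFields.YangMills.Theorems.BalabanUVNodesN20StubTwoTextVOfKeyedHybridCertificate

/-!
# YM-DAG node N19 (= NE7 proper) — THE HYBRID CHAIN RULE, part 3: AT ORIGIN `0` (no shift, early levels matched whole) and ITS SOCKET AT THE RECORD —
# two hybrid legs through ANY intermediate family at the record's carriers ⇒ dag-n20-w3's keyed hybrid certificate (module 13U) ⇒ K3⁸ v6 stub 2's TEXT, by name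

Cell `pub-ymgap`, HUMAN RULING D-0062 (Track A) + D-0149 (width seats, director-ym №197), WIDTH SEAT `pub-ymgap-dag-n19-w1` (N19 NE7, seat 1 of 3),
generation g6, FILE 3; bus CLAIM-3 (HOME `INBOX.md`).  Route `Summits/QuantumFields/YangMills/Theses/BalabanUVNodes.lean`, key item K3⁸
«SpineGivenEndpointR13SepCoPHV» (stmt-QuantumFields-27366; registered skeleton «v6» b4e55110ab73e679, stubs `stub_rates13HV` ∕ `stub_expansion13HV`); filed
`--kind proof --supports` that item `--as helper` (it proves no registered stub: every leg is a HYPOTHESIS).  COUNT-NEUTRAL.  THEOREMS ONLY; 0 `def`; 0 `sorry`.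
Imports FILE 2 `…N19HybridChainRuleTower` (hence FILE 1; this seat, g6), this seat's g3 `…N19EventualBinderList` (p605733: `hybridNE7_eventually` — «`lt_one` is never the
obstruction») and dag-n20-w3's module 13U `…N20StubTwoTextVOfKeyedHybridCertificate` (p637589; the keyed-certificate ⇒ stub-2-text knit) — all CITED BY NAME.

THE POINT (numbers, not adjectives).  FILE 1's chain rule concludes in the from-`K₀`-on currency (`∃ K₀`, shifted data), because the composed bad weight is `< 1` only
eventually.  But K3⁸ v6 stub 2 is PINNED AT ORIGIN `0`: dag-n20-w3's module 13U consumes, per guarded admissible Stage-13 tuple and `(g₀, os)`, a certificate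
`∃ Bad W shA shB Wsh δ, HybridNE7 1 (F.side⁴) (classSet₁₃ θ 0 g₀) (weightA₁₃ θ hP 0 g₀ os) (weightB₁₃ θ hP 0 g₀ os) Bad W shA shB Wsh δ` — ALL levels `K ≥ 0`.  The gap
is exactly this seat's g3 lemma `N19EventualBinderList.hybridNE7_eventually`: given the composed weight inequalities WITHOUT `< 1`, the composed shells, core and radius, and
ONE more binder — an ALL-TERMS RADIUS `R_K` per level for the end pair («positivity matching»: `e^{c ∓ vol·R_K}·A ≶ B` on ALL of `T K`; any finite `R_K`, no summability) —
the binder list holds FROM LEVEL `0` with the bad classes EMPTIED and the shells ZEROED before the level `K₀` where the composed weight drops below `1`, radius `R` there and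
`δ₁ + δ₂` after.  §1 is that composition (`hybridNE7_trans_origin`; the all-terms radius of the end pair composes from per-leg ones, `allTerms_trans`; ∃-currency
`hybridNE7Edge_trans_origin` = 13U's certificate shape); §2 PRODUCES the extra binder from POSITIVITY + CONTINUITY in the source of the two end families on `|t| ≤ l₀`
(`exists_allTermsRadius_of_pos_continuousOn`: a continuous positive ratio on a compact source window and a finite class set has a finite log-oscillation; `c = 0`);
§1 also has the SMALL-LEGS edition `hybridNE7_trans_of_small` (every level: bad + shell weight `≤ 1∕8` and `2·vol·δ ≤ log 2` per leg ⇒ composed weight + shells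
`≤ 37∕56 < 1`, so FILE 1's all-levels edition applies with NO zeroing) — the edition for carriers WITHOUT an all-terms radius: at the record a class reached by ONE run only
has weight `0` in the other, and `hall` would force `B = 0` wherever `A = 0`.
§3 is the socket: ★★★ `keyedHybridNE7_of_keyedLegs` (per tuple: ANY intermediate family `M` with shells `shM` on the record's coarse carriers at origin `0`, two hybrid legs
`weightA₁₃ → M → weightB₁₃` and an all-terms radius ⇒ 13U's certificate `hH`) and ★★★ `keyedHybridNE7_of_keyedSmallLegs` (small legs, no radius ⇒ `hH`), whence BY NAME
★★ `stubExpansion13HVText_of_keyedLegs_of_liveLine` ∕ `…_of_keyedSmallLegs_of_liveLine` (+ the keyed live line ⇒ the REGISTERED v6 TEXT of `stub_expansion13HV`) and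
★ `spineGivenEndpointR13SepCoPHV_of_stubRates13HVText_of_keyedLegs_of_liveLine` (K3⁸ by name MODULO stub 1's text).

§4 is the PREFIX-LEVEL socket ★★★ `spineGivenEndpointR13SepCoPHV_of_legsUnderPrefix`: K3⁸ BY NAME from «per guarded admissible slot tuple, under (B) → END →
`ForSmallCouplings`: every string has SOME carriers from SOME origin with the E1∕E2 dictionary and an intermediate family with two hybrid legs» — FILE 2 §7
`hybridNE7Under_of_legs` (binder B5's origin is existential: dag-n27-a's `hybridNE7Under_iff_spineNodes_tail`), so NO origin-`0` pin, NO radius, NO smallness, NO live line,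
NO K4 — the item asks less than v6's stub 2 text.

READING (located; nothing proposed).  A road THROUGH an intermediate object (H1L's re-blocked run, a window truncation, a partially resummed gas) owes at v6's pin: the two
legs at the record's origin-`0` carriers, the keyed live line, and the end pair's radius OR the legs' smallness (§3); at the ITEM: only the legs + dictionary under the prefix (§4).

HONEST FRAMING.  Every leg, the live line and the radius are HYPOTHESES; nothing of Bałaban's is asserted or instantiated; N19 ∕ N20 ∕ N21 NOT discharged; K3⁸ OPEN (no stub
claimed); Track A counts UNMOVED (28∕28 · 5∕27).  R4 closes the conditional finite-𝕋⁴ rung `BalabanLadder.UV` only — NOT a mass gap; the YM mass gap (Clay) is NOT proved by this.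
-/

set_option autoImplicit false

noncomputable section

open Finset Filter Topology
open scoped BigOperators

namespace Summit.QuantumFields.YangMills.BalabanUVNodes.N19HybridChainRuleAtOrigin

open Literature.MathematicalPhysics.QuantumFieldTheory.Balaban1983to89
open T4WeightBudget (RelWeightBound)
open T4IndicatorShell (ShellWeightBound)
open T4MatchingAssembly (HybridNE7 hybridNE7_of_relWeightBound)
open Summit.QuantumFields.BalabanUV.T4Continuum.Spine
open Summit.QuantumFields.YangMills.BalabanUVNodes.N19CoreMetric (core_trans core_trans_union)
open Summit.QuantumFields.YangMills.BalabanUVNodes.N19EventualBinderList (hybridNE7_eventually)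
open Summit.QuantumFields.YangMills.BalabanUVNodes.N19HybridChainRule (sum_badUnion_left_le sum_badUnion_right_le summable_transWeight
  shellWeightBound_trans)

/-! ## §1 The chain rule at origin `0` [folklore ∘ FILE 1 ∘ g3] -/

section Origin

variable {ι : Type*} [DecidableEq ι] {l₀ vol : ℝ} {T : ℕ → Finset ι} {A M B shA shM shB : ℕ → ℝ → ι → ℝ}
  {Bad₁ Bad₂ : ℕ → ℝ → Finset ι} {W₁ W₂ Wsh₁ Wsh₂ δ₁ δ₂ R R₁ R₂ : ℕ → ℝ}

omit [DecidableEq ι] in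
/-- **ALL-TERMS RADII COMPOSE** [folklore]: positivity matching `A ↔ M` with radius `R₁` and `M ↔ B` with radius `R₂` (one constant per level, ALL classes) give positivity
matching `A ↔ B` with radius `R₁ + R₂` (`N19CoreMetric.core_trans` at the empty bad class). -/
theorem allTerms_trans
    (h₁ : ∀ K : ℕ, ∃ c : ℝ, ∀ t : ℝ, |t| ≤ l₀ → ∀ τ ∈ T K,
      Real.exp (c - vol * R₁ K) * A K t τ ≤ M K t τ ∧ M K t τ ≤ Real.exp (c + vol * R₁ K) * A K t τ)
    (h₂ : ∀ K : ℕ, ∃ c : ℝ, ∀ t : ℝ, |t| ≤ l₀ → ∀ τ ∈ T K,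
      Real.exp (c - vol * R₂ K) * M K t τ ≤ B K t τ ∧ B K t τ ≤ Real.exp (c + vol * R₂ K) * M K t τ) :
    ∀ K : ℕ, ∃ c : ℝ, ∀ t : ℝ, |t| ≤ l₀ → ∀ τ ∈ T K,
      Real.exp (c - vol * (R₁ K + R₂ K)) * A K t τ ≤ B K t τ ∧ B K t τ ≤ Real.exp (c + vol * (R₁ K + R₂ K)) * A K t τ := by
  classical
  have h₁' : NE7.Core l₀ vol T (fun _ _ => ∅) A M R₁ := fun K => by
    obtain ⟨c, hc⟩ := h₁ K
    exact ⟨c, fun t ht τ hτ => hc t ht τ (by simpa using hτ)⟩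
  have h₂' : NE7.Core l₀ vol T (fun _ _ => ∅) M B R₂ := fun K => by
    obtain ⟨c, hc⟩ := h₂ K
    exact ⟨c, fun t ht τ hτ => hc t ht τ (by simpa using hτ)⟩
  intro K
  obtain ⟨c, hc⟩ := core_trans h₁' h₂' K
  exact ⟨c, fun t ht τ hτ => hc t ht τ (by simpa using hτ)⟩

/-- ★★ **THE HYBRID CHAIN RULE AT ORIGIN `0`** [folklore].  Two legs `HybridNE7 … A M Bad₁ W₁ shA shM Wsh₁ δ₁`, `HybridNE7 … M B Bad₂ W₂ shM shB Wsh₂ δ₂` and an ALL-TERMS radius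
`R` for the end pair (`e^{c ∓ vol·R_K}·A ≶ B` on all of `T K`, one `c` per level) ⇒ the binder list of `(A, B)` FROM LEVEL `0`: from the level `K₀` where FILE 1's composed weight
`+ Wsh₁ + Wsh₂` drops below `1` on, bad class `Bad₁ ∪ Bad₂`, the transported `max` weight, shells `shA ∕ shB` at `Wsh₁ + Wsh₂`, radius `δ₁ + δ₂`; before `K₀`, NO bad class, NO
shells, radius `R` (the early levels are matched whole).  = this seat's g3 `N19EventualBinderList.hybridNE7_eventually` fed with FILE 1 §2. -/
theorem hybridNE7_trans_origin (h₁ : HybridNE7 l₀ vol T A M Bad₁ W₁ shA shM Wsh₁ δ₁) (h₂ : HybridNE7 l₀ vol T M B Bad₂ W₂ shM shB Wsh₂ δ₂)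
    (hall : ∀ K : ℕ, ∃ c : ℝ, ∀ t : ℝ, |t| ≤ l₀ → ∀ τ ∈ T K,
      Real.exp (c - vol * R K) * A K t τ ≤ B K t τ ∧ B K t τ ≤ Real.exp (c + vol * R K) * A K t τ) :
    ∃ K₀ : ℕ, HybridNE7 l₀ vol T A B (fun K t => if K₀ ≤ K then Bad₁ K t ∪ Bad₂ K t else ∅)
      (Set.indicator {K | K₀ ≤ K} fun K =>
        max (W₁ K + Wsh₁ K + Real.exp (2 * (vol * δ₁ K)) * W₂ K / (1 - W₁ K - Wsh₁ K))
          (W₂ K + Wsh₂ K + Real.exp (2 * (vol * δ₂ K)) * W₁ K / (1 - W₂ K - Wsh₂ K)))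
      (fun K t τ => if K₀ ≤ K then shA K t τ else 0) (fun K t τ => if K₀ ≤ K then shB K t τ else 0)
      (Set.indicator {K | K₀ ≤ K} fun K => Wsh₁ K + Wsh₂ K) fun K => if K₀ ≤ K then δ₁ K + δ₂ K else R K :=
  hybridNE7_eventually (Bad := fun K t => Bad₁ K t ∪ Bad₂ K t)
    (fun K t ht => Finset.union_subset (h₁.weight.bad_subset K t ht) (h₂.weight.bad_subset K t ht))
    (summable_transWeight h₁ h₂).1 (summable_transWeight h₁ h₂).2
    (fun K t ht => (sum_badUnion_left_le h₁ h₂ K t ht).trans (mul_le_mul_of_nonneg_right (le_max_left _ _)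
      (Finset.sum_nonneg fun τ hτ => (h₁.shell.sh_nonneg_left K t ht τ hτ).trans (h₁.shell.sh_le_left K t ht τ hτ))))
    (fun K t ht => (sum_badUnion_right_le h₁ h₂ K t ht).trans (mul_le_mul_of_nonneg_right (le_max_right _ _)
      (Finset.sum_nonneg fun τ hτ => (h₂.shell.sh_nonneg_right K t ht τ hτ).trans (h₂.shell.sh_le_right K t ht τ hτ))))
    (shellWeightBound_trans h₁ h₂) (core_trans_union h₁.core h₂.core) (h₁.summable.add h₂.summable) hall

/-- **… WITH PER-LEG ALL-TERMS RADII** [folklore]: the end pair's radius `R₁ + R₂` from the legs' (`allTerms_trans`). -/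
theorem hybridNE7_trans_origin_of_legRadii (h₁ : HybridNE7 l₀ vol T A M Bad₁ W₁ shA shM Wsh₁ δ₁) (h₂ : HybridNE7 l₀ vol T M B Bad₂ W₂ shM shB Wsh₂ δ₂)
    (hR₁ : ∀ K : ℕ, ∃ c : ℝ, ∀ t : ℝ, |t| ≤ l₀ → ∀ τ ∈ T K,
      Real.exp (c - vol * R₁ K) * A K t τ ≤ M K t τ ∧ M K t τ ≤ Real.exp (c + vol * R₁ K) * A K t τ)
    (hR₂ : ∀ K : ℕ, ∃ c : ℝ, ∀ t : ℝ, |t| ≤ l₀ → ∀ τ ∈ T K,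
      Real.exp (c - vol * R₂ K) * M K t τ ≤ B K t τ ∧ B K t τ ≤ Real.exp (c + vol * R₂ K) * M K t τ) :
    ∃ K₀ : ℕ, HybridNE7 l₀ vol T A B (fun K t => if K₀ ≤ K then Bad₁ K t ∪ Bad₂ K t else ∅)
      (Set.indicator {K | K₀ ≤ K} fun K =>
        max (W₁ K + Wsh₁ K + Real.exp (2 * (vol * δ₁ K)) * W₂ K / (1 - W₁ K - Wsh₁ K))
          (W₂ K + Wsh₂ K + Real.exp (2 * (vol * δ₂ K)) * W₁ K / (1 - W₂ K - Wsh₂ K)))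
      (fun K t τ => if K₀ ≤ K then shA K t τ else 0) (fun K t τ => if K₀ ≤ K then shB K t τ else 0)
      (Set.indicator {K | K₀ ≤ K} fun K => Wsh₁ K + Wsh₂ K) fun K => if K₀ ≤ K then δ₁ K + δ₂ K else R₁ K + R₂ K :=
  hybridNE7_trans_origin h₁ h₂ (allTerms_trans hR₁ hR₂)

/-- ★★ **THE ∃-CURRENCY AT ORIGIN `0`** [folklore] — the shape of dag-n20-w3's keyed certificate (module 13U): legs for SOME bad classes ∕ weights ∕ shell weight ∕ radius (middle
shell shared) + an all-terms radius for the end pair ⇒ `∃ Bad W shA′ shB′ Wsh δ, HybridNE7 l₀ vol T A B Bad W shA′ shB′ Wsh δ` (UNSHIFTED; the shells `shA′ ∕ shB′` are the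
end shells zeroed below `K₀`). -/
theorem hybridNE7Edge_trans_origin
    (h₁ : ∃ (Bad₁ : ℕ → ℝ → Finset ι) (W₁ Wsh₁ δ₁ : ℕ → ℝ), HybridNE7 l₀ vol T A M Bad₁ W₁ shA shM Wsh₁ δ₁)
    (h₂ : ∃ (Bad₂ : ℕ → ℝ → Finset ι) (W₂ Wsh₂ δ₂ : ℕ → ℝ), HybridNE7 l₀ vol T M B Bad₂ W₂ shM shB Wsh₂ δ₂)
    (hall : ∃ R : ℕ → ℝ, ∀ K : ℕ, ∃ c : ℝ, ∀ t : ℝ, |t| ≤ l₀ → ∀ τ ∈ T K,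
      Real.exp (c - vol * R K) * A K t τ ≤ B K t τ ∧ B K t τ ≤ Real.exp (c + vol * R K) * A K t τ) :
    ∃ (Bad : ℕ → ℝ → Finset ι) (W : ℕ → ℝ) (shA' shB' : ℕ → ℝ → ι → ℝ) (Wsh δ : ℕ → ℝ),
      HybridNE7 l₀ vol T A B Bad W shA' shB' Wsh δ := by
  obtain ⟨Bad₁, W₁, Wsh₁, δ₁, h₁⟩ := h₁
  obtain ⟨Bad₂, W₂, Wsh₂, δ₂, h₂⟩ := h₂
  obtain ⟨R, hall⟩ := hall
  obtain ⟨K₀, h⟩ := hybridNE7_trans_origin h₁ h₂ hall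
  exact ⟨_, _, _, _, _, _, h⟩

/-- ★★ **THE CHAIN RULE AT ORIGIN `0` UNDER NUMERIC SMALLNESS OF THE LEGS** [folklore] — the edition for carriers on which the end pair has NO all-terms radius (at the record:
classes reached by one run only carry weight `0` in the other, and `hall` would force `B = 0` wherever `A = 0`).  If at EVERY level each leg's bad-plus-shell weight is `≤ 1∕8`
and each leg's radius has `2·vol·δ ≤ log 2`, then FILE 1's composed weight is `≤ 1∕8 + 2∕7` and with the shells `≤ 37∕56 < 1`, so FILE 1's `hybridNE7_trans_of_lt_one` gives the
binder list of `(A, B)` from level `0` with NO zeroing: bad class `Bad₁ ∪ Bad₂`, the transported `max` weight, shells `shA ∕ shB` at `Wsh₁ + Wsh₂`, radius `δ₁ + δ₂`. -/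
theorem hybridNE7_trans_of_small (h₁ : HybridNE7 l₀ vol T A M Bad₁ W₁ shA shM Wsh₁ δ₁) (h₂ : HybridNE7 l₀ vol T M B Bad₂ W₂ shM shB Wsh₂ δ₂)
    (hs₁ : ∀ K, W₁ K + Wsh₁ K ≤ 1 / 8) (hs₂ : ∀ K, W₂ K + Wsh₂ K ≤ 1 / 8)
    (hr₁ : ∀ K, 2 * (vol * δ₁ K) ≤ Real.log 2) (hr₂ : ∀ K, 2 * (vol * δ₂ K) ≤ Real.log 2) :
    HybridNE7 l₀ vol T A B (fun K t => Bad₁ K t ∪ Bad₂ K t)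
      (fun K => max (W₁ K + Wsh₁ K + Real.exp (2 * (vol * δ₁ K)) * W₂ K / (1 - W₁ K - Wsh₁ K))
        (W₂ K + Wsh₂ K + Real.exp (2 * (vol * δ₂ K)) * W₁ K / (1 - W₂ K - Wsh₂ K)))
      shA shB (fun K => Wsh₁ K + Wsh₂ K) fun K => δ₁ K + δ₂ K := by
  refine N19HybridChainRule.hybridNE7_trans_of_lt_one h₁ h₂ fun K => ?_
  have two_pos : (0 : ℝ) < 2 := by norm_num
  have he₁ : Real.exp (2 * (vol * δ₁ K)) ≤ 2 := by simpa [Real.exp_log two_pos] using Real.exp_le_exp.mpr (hr₁ K)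
  have he₂ : Real.exp (2 * (vol * δ₂ K)) ≤ 2 := by simpa [Real.exp_log two_pos] using Real.exp_le_exp.mpr (hr₂ K)
  have hW₁ := h₁.weight.nonneg K
  have hW₂ := h₂.weight.nonneg K
  have hWsh₁ := h₁.shell.nonneg K
  have hWsh₂ := h₂.shell.nonneg K
  have hd₁ : 7 / 8 ≤ 1 - W₁ K - Wsh₁ K := by linarith [hs₁ K]
  have hd₂ : 7 / 8 ≤ 1 - W₂ K - Wsh₂ K := by linarith [hs₂ K]
  have hn₁ : Real.exp (2 * (vol * δ₁ K)) * W₂ K ≤ 2 * (1 / 8) :=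
    mul_le_mul he₁ (by linarith [hs₂ K]) hW₂ two_pos.le
  have hn₂ : Real.exp (2 * (vol * δ₂ K)) * W₁ K ≤ 2 * (1 / 8) :=
    mul_le_mul he₂ (by linarith [hs₁ K]) hW₁ two_pos.le
  have hq₁ : Real.exp (2 * (vol * δ₁ K)) * W₂ K / (1 - W₁ K - Wsh₁ K) ≤ 2 / 7 := by
    rw [div_le_iff₀ (by linarith)]
    linarith
  have hq₂ : Real.exp (2 * (vol * δ₂ K)) * W₁ K / (1 - W₂ K - Wsh₂ K) ≤ 2 / 7 := by
    rw [div_le_iff₀ (by linarith)]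
    linarith
  have hmax : max (W₁ K + Wsh₁ K + Real.exp (2 * (vol * δ₁ K)) * W₂ K / (1 - W₁ K - Wsh₁ K))
      (W₂ K + Wsh₂ K + Real.exp (2 * (vol * δ₂ K)) * W₁ K / (1 - W₂ K - Wsh₂ K)) ≤ 1 / 8 + 2 / 7 :=
    max_le (by linarith [hs₁ K]) (by linarith [hs₂ K])
  linarith [hs₁ K, hs₂ K]

/-- **… in the ∃-currency** (13U's certificate shape, with the end shells themselves): small legs ⇒ `∃ Bad W Wsh δ, HybridNE7 l₀ vol T A B Bad W shA shB Wsh δ`. [folklore] -/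
theorem hybridNE7Edge_trans_of_small
    (h : ∃ (Bad₁ : ℕ → ℝ → Finset ι) (W₁ Wsh₁ δ₁ : ℕ → ℝ) (Bad₂ : ℕ → ℝ → Finset ι) (W₂ Wsh₂ δ₂ : ℕ → ℝ),
      HybridNE7 l₀ vol T A M Bad₁ W₁ shA shM Wsh₁ δ₁ ∧ HybridNE7 l₀ vol T M B Bad₂ W₂ shM shB Wsh₂ δ₂ ∧
        (∀ K, W₁ K + Wsh₁ K ≤ 1 / 8) ∧ (∀ K, W₂ K + Wsh₂ K ≤ 1 / 8) ∧ (∀ K, 2 * (vol * δ₁ K) ≤ Real.log 2) ∧ (∀ K, 2 * (vol * δ₂ K) ≤ Real.log 2)) :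
    ∃ (Bad : ℕ → ℝ → Finset ι) (W Wsh δ : ℕ → ℝ), HybridNE7 l₀ vol T A B Bad W shA shB Wsh δ := by
  obtain ⟨Bad₁, W₁, Wsh₁, δ₁, Bad₂, W₂, Wsh₂, δ₂, h₁, h₂, hs₁, hs₂, hr₁, hr₂⟩ := h
  exact ⟨_, _, _, _, hybridNE7_trans_of_small h₁ h₂ hs₁ hs₂ hr₁ hr₂⟩

end Origin

/-! ## §2 The all-terms radius from positivity and source-continuity [folklore] -/

section Radius

variable {ι : Type*} {l₀ vol : ℝ} {T : ℕ → Finset ι} {A B : ℕ → ℝ → ι → ℝ}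

/-- ★ **POSITIVITY MATCHING IS FREE FOR POSITIVE, SOURCE-CONTINUOUS FAMILIES** [folklore].  If on the source window `|t| ≤ l₀` every term of the two families is POSITIVE and
CONTINUOUS in `t`, then for every level there is a finite all-terms radius: `e^{0 ∓ vol·R_K}·A ≶ B` on all of `T K` (`R_K :=` the sum over the finite class set of each class's
bound of `|log B − log A|` on the compact window, divided by `vol > 0`; `IsCompact.exists_bound_of_continuousOn`, `NE7.sandwich_of_abs_log_sub_le`).  No summability is
claimed or needed (FILE 3 §1 reads `R` only below `K₀`). -/
theorem exists_allTermsRadius_of_pos_continuousOn (hvol : 0 < vol)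
    (hA : ∀ (K : ℕ) (t : ℝ), |t| ≤ l₀ → ∀ τ ∈ T K, 0 < A K t τ) (hB : ∀ (K : ℕ) (t : ℝ), |t| ≤ l₀ → ∀ τ ∈ T K, 0 < B K t τ)
    (hcA : ∀ (K : ℕ), ∀ τ ∈ T K, ContinuousOn (fun t => A K t τ) (Set.Icc (-l₀) l₀))
    (hcB : ∀ (K : ℕ), ∀ τ ∈ T K, ContinuousOn (fun t => B K t τ) (Set.Icc (-l₀) l₀)) :
    ∃ R : ℕ → ℝ, ∀ K : ℕ, ∃ c : ℝ, ∀ t : ℝ, |t| ≤ l₀ → ∀ τ ∈ T K,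
      Real.exp (c - vol * R K) * A K t τ ≤ B K t τ ∧ B K t τ ≤ Real.exp (c + vol * R K) * A K t τ := by
  have hIcc : ∀ {t : ℝ}, |t| ≤ l₀ → t ∈ Set.Icc (-l₀) l₀ := fun ht => Set.mem_Icc.mpr (abs_le.mp ht)
  -- per class: a bound of the log-ratio on the compact window
  have hbd : ∀ (K : ℕ) (τ : ι), ∃ b : ℝ, 0 ≤ b ∧ (τ ∈ T K → ∀ t : ℝ, |t| ≤ l₀ → |Real.log (B K t τ) - Real.log (A K t τ)| ≤ b) := by
    intro K τ
    by_cases hτ : τ ∈ T K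
    · have hc : ContinuousOn (fun t => Real.log (B K t τ) - Real.log (A K t τ)) (Set.Icc (-l₀) l₀) :=
        ((hcB K τ hτ).log fun t ht => (hB K t (abs_le.mpr (Set.mem_Icc.mp ht)) τ hτ).ne').sub
          ((hcA K τ hτ).log fun t ht => (hA K t (abs_le.mpr (Set.mem_Icc.mp ht)) τ hτ).ne')
      obtain ⟨C, hC⟩ := isCompact_Icc.exists_bound_of_continuousOn hc
      refine ⟨max C 0, le_max_right _ _, fun _ t ht => ?_⟩
      exact ((Real.norm_eq_abs _).symm.le.trans (hC t (hIcc ht))).trans (le_max_left _ _)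
    · exact ⟨0, le_rfl, fun h => absurd h hτ⟩
  choose b hb0 hb using hbd
  refine ⟨fun K => (∑ τ ∈ T K, b K τ) / vol, fun K => ⟨0, fun t ht τ hτ => ?_⟩⟩
  have hle : |Real.log (B K t τ) - Real.log (A K t τ) - 0| ≤ vol * ((∑ σ ∈ T K, b K σ) / vol) := by
    rw [sub_zero, mul_div_cancel₀ _ hvol.ne']
    exact (hb K τ hτ t ht).trans (Finset.single_le_sum (fun σ _ => hb0 K σ) hτ)
  exact NE7.sandwich_of_abs_log_sub_le (hA K t ht τ hτ) (hB K t ht τ hτ) hle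

end Radius

/-! ## §3 The socket at the record: two legs through ANY intermediate family ⇒ module 13U's keyed certificate ⇒ stub 2's v6 text [bookkeeping] -/

section Record

open Literature.MathematicalPhysics.QuantumFieldTheory.Balaban1983to89.T4Continuum
open Literature.MathematicalPhysics.QuantumFieldTheory.Balaban1983to89.Node00
open YMDAG.UVSplit hiding SU
open Summit.QuantumFields.YangMills.Theorems.K3V5Defs (SpineReading RateReadingFn RunSel LetterReading CutReading rrOfRecord GuardedReadingN16
  KeyedRelWeight KeyedShellWeight LiveSel PinnedAtLive)
open Summit.QuantumFields.YangMills.Theorems.K3V6Defs (KeyedRatesHolderD4V KeyedCoreEdgeHolderD4V KeyedExtractionV)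
open Summit.QuantumFields.YangMills.BalabanUVNodes.N20StubTwoTextVOfKeyedHybridCertificate (stubExpansion13HVText_of_keyedHybridNE7_of_liveLine
  spineGivenEndpointR13SepCoPHV_of_stubRates13HVText_of_keyedHybridNE7_of_liveLine)

/-- ★★★ **TWO HYBRID LEGS THROUGH ANY INTERMEDIATE FAMILY AT THE RECORD's ORIGIN-`0` CARRIERS GIVE dag-n20-w3's KEYED HYBRID CERTIFICATE** (module 13U's hypothesis `hH`, any bad
class).  Per guarded admissible Stage-13 tuple `(F, θ, hP)` and `(g₀, os)`: SOME family `M` with shells `shM` on the coarse carriers `Σ K, SiteSeqKey F (0 + K)`, end shells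
`shA ∕ shB`, the two legs `HybridNE7 1 (F.side⁴) (classSet₁₃ θ 0 g₀) (weightA₁₃ θ hP 0 g₀ os) M …` and `HybridNE7 1 (F.side⁴) (classSet₁₃ θ 0 g₀) M (weightB₁₃ θ hP 0 g₀ os) …`
(each for SOME bad classes ∕ weights ∕ shell weight ∕ radius), and an all-terms radius for the end pair (§2 produces it from positivity + source-continuity) ⇒ `hH`
(§1 `hybridNE7Edge_trans_origin` per tuple).  `M` is NOT a run of the record and carries no dictionary.  The legs are HYPOTHESES. -/
theorem keyedHybridNE7_of_keyedLegs
    (hLegs : ∀ (F : T4Family) (θ : Stage13HParams F 2) (hP : θ.Provisos₁₃CoPH F 2), (θ.ZhUnity F 2 ∧ θ.SlotsNondegenerate₁₃ F 2) → θ.Admissible F 2 →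
      ∀ (g₀ : ℕ → ℝ) (os : List (ULoop F)),
        letI : DecidableEq (Σ K, SiteSeqKey F (0 + K)) := Classical.decEq _
        ∃ (M shA shM shB : ℕ → ℝ → (Σ K, SiteSeqKey F (0 + K)) → ℝ),
          (∃ (Bad : ℕ → ℝ → Finset (Σ K, SiteSeqKey F (0 + K))) (W Wsh δ : ℕ → ℝ),
            HybridNE7 1 (F.side ^ 4) (classSet₁₃ θ 0 g₀) (weightA₁₃ θ hP 0 g₀ os) M Bad W shA shM Wsh δ) ∧
          (∃ (Bad : ℕ → ℝ → Finset (Σ K, SiteSeqKey F (0 + K))) (W Wsh δ : ℕ → ℝ),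
            HybridNE7 1 (F.side ^ 4) (classSet₁₃ θ 0 g₀) M (weightB₁₃ θ hP 0 g₀ os) Bad W shM shB Wsh δ) ∧
          (∃ R : ℕ → ℝ, ∀ K : ℕ, ∃ c : ℝ, ∀ t : ℝ, |t| ≤ 1 → ∀ x ∈ classSet₁₃ θ 0 g₀ K,
            Real.exp (c - F.side ^ 4 * R K) * weightA₁₃ θ hP 0 g₀ os K t x ≤ weightB₁₃ θ hP 0 g₀ os K t x ∧
              weightB₁₃ θ hP 0 g₀ os K t x ≤ Real.exp (c + F.side ^ 4 * R K) * weightA₁₃ θ hP 0 g₀ os K t x)) :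
    ∀ (F : T4Family) (θ : Stage13HParams F 2) (hP : θ.Provisos₁₃CoPH F 2), (θ.ZhUnity F 2 ∧ θ.SlotsNondegenerate₁₃ F 2) → θ.Admissible F 2 →
      ∀ (g₀ : ℕ → ℝ) (os : List (ULoop F)),
        letI : DecidableEq (Σ K, SiteSeqKey F (0 + K)) := Classical.decEq _
        ∃ (Bad : ℕ → ℝ → Finset (Σ K, SiteSeqKey F (0 + K))) (W : ℕ → ℝ) (shA shB : ℕ → ℝ → (Σ K, SiteSeqKey F (0 + K)) → ℝ) (Wsh δ : ℕ → ℝ),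
          HybridNE7 1 (F.side ^ 4) (classSet₁₃ θ 0 g₀) (weightA₁₃ θ hP 0 g₀ os) (weightB₁₃ θ hP 0 g₀ os) Bad W shA shB Wsh δ := by
  intro F θ hP hG hθ g₀ os
  letI : DecidableEq (Σ K, SiteSeqKey F (0 + K)) := Classical.decEq _
  obtain ⟨M, shA, shM, shB, h₁, h₂, hall⟩ := hLegs F θ hP hG hθ g₀ os
  exact hybridNE7Edge_trans_origin h₁ h₂ hall

/-- ★★ **K3⁸ v6 STUB 2's TEXT FROM TWO KEYED LEGS AND THE KEYED LIVE LINE** [bookkeeping]: §3's certificate fed to dag-n20-w3's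
`N20StubTwoTextVOfKeyedHybridCertificate.stubExpansion13HVText_of_keyedHybridNE7_of_liveLine` (fold of the bad class into the shells, witness `(0, sh⋆, crOfRecord₁₃V 0 sh⋆)`,
extraction face from the live line).  The legs and the live line are HYPOTHESES; NOT a proof of `stub_expansion13HV`. -/
theorem stubExpansion13HVText_of_keyedLegs_of_liveLine
    (hLegs : ∀ (F : T4Family) (θ : Stage13HParams F 2) (hP : θ.Provisos₁₃CoPH F 2), (θ.ZhUnity F 2 ∧ θ.SlotsNondegenerate₁₃ F 2) → θ.Admissible F 2 →
      ∀ (g₀ : ℕ → ℝ) (os : List (ULoop F)),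
        letI : DecidableEq (Σ K, SiteSeqKey F (0 + K)) := Classical.decEq _
        ∃ (M shA shM shB : ℕ → ℝ → (Σ K, SiteSeqKey F (0 + K)) → ℝ),
          (∃ (Bad : ℕ → ℝ → Finset (Σ K, SiteSeqKey F (0 + K))) (W Wsh δ : ℕ → ℝ),
            HybridNE7 1 (F.side ^ 4) (classSet₁₃ θ 0 g₀) (weightA₁₃ θ hP 0 g₀ os) M Bad W shA shM Wsh δ) ∧
          (∃ (Bad : ℕ → ℝ → Finset (Σ K, SiteSeqKey F (0 + K))) (W Wsh δ : ℕ → ℝ),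
            HybridNE7 1 (F.side ^ 4) (classSet₁₃ θ 0 g₀) M (weightB₁₃ θ hP 0 g₀ os) Bad W shM shB Wsh δ) ∧
          (∃ R : ℕ → ℝ, ∀ K : ℕ, ∃ c : ℝ, ∀ t : ℝ, |t| ≤ 1 → ∀ x ∈ classSet₁₃ θ 0 g₀ K,
            Real.exp (c - F.side ^ 4 * R K) * weightA₁₃ θ hP 0 g₀ os K t x ≤ weightB₁₃ θ hP 0 g₀ os K t x ∧
              weightB₁₃ θ hP 0 g₀ os K t x ≤ Real.exp (c + F.side ^ 4 * R K) * weightA₁₃ θ hP 0 g₀ os K t x))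
    (hlive : ∀ (F : T4Family) (θ : Stage13HParams F 2), θ.Provisos₁₃CoPH F 2 → (θ.ZhUnity F 2 ∧ θ.SlotsNondegenerate₁₃ F 2) → θ.Admissible F 2 →
      LiveSel F θ ∧ ZetaMeasurable F 2 θ.ζ) :
    ∀ β : ℝ, 2 / 3 < β → β < 1 →
      ∀ (𝔯 : RateReading₁₃CoPH 2) (ksel : RunSel) (ℓ : LetterReading) (ℓ₃ : T4Family → Node00.NE3Letters₁₁) (g B : T4Family → ℝ),
        GuardedReadingN16 𝔯 ksel ℓ ℓ₃ g B → KeyedRatesHolderD4V β (rrOfRecord 𝔯 ksel) →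
        ∃ (jc : CutReading) (sh : ShellSplit₁₃CoPH 2 0) (cr : SpineReading), PinnedAtLive jc sh cr ∧
          KeyedRelWeight cr ∧ KeyedShellWeight cr ∧ KeyedExtractionV cr ∧ KeyedCoreEdgeHolderD4V β cr (rrOfRecord 𝔯 ksel) :=
  stubExpansion13HVText_of_keyedHybridNE7_of_liveLine (keyedHybridNE7_of_keyedLegs hLegs) hlive

/-- ★ **K3⁸ BY NAME MODULO STUB 1's v6 TEXT, FROM TWO KEYED LEGS** [bookkeeping]: stub 1's registered text + the keyed legs + the keyed live line ⇒
`Theses.BalabanUVNodes.SpineGivenEndpointR13SepCoPHV` (dag-n20-w3's `spineGivenEndpointR13SepCoPHV_of_stubRates13HVText_of_keyedHybridNE7_of_liveLine`).  NOT a proof of K3⁸: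
all inputs are HYPOTHESES inhabited for no tuple. -/
theorem spineGivenEndpointR13SepCoPHV_of_stubRates13HVText_of_keyedLegs_of_liveLine
    (h₁ : ∃ β : ℝ, 2 / 3 < β ∧ β < 1 ∧
      ∃ (𝔯 : RateReading₁₃CoPH 2) (ksel : RunSel) (ℓ : LetterReading) (ℓ₃ : T4Family → Node00.NE3Letters₁₁) (g B : T4Family → ℝ),
        GuardedReadingN16 𝔯 ksel ℓ ℓ₃ g B ∧ KeyedRatesHolderD4V β (rrOfRecord 𝔯 ksel))
    (hLegs : ∀ (F : T4Family) (θ : Stage13HParams F 2) (hP : θ.Provisos₁₃CoPH F 2), (θ.ZhUnity F 2 ∧ θ.SlotsNondegenerate₁₃ F 2) → θ.Admissible F 2 →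
      ∀ (g₀ : ℕ → ℝ) (os : List (ULoop F)),
        letI : DecidableEq (Σ K, SiteSeqKey F (0 + K)) := Classical.decEq _
        ∃ (M shA shM shB : ℕ → ℝ → (Σ K, SiteSeqKey F (0 + K)) → ℝ),
          (∃ (Bad : ℕ → ℝ → Finset (Σ K, SiteSeqKey F (0 + K))) (W Wsh δ : ℕ → ℝ),
            HybridNE7 1 (F.side ^ 4) (classSet₁₃ θ 0 g₀) (weightA₁₃ θ hP 0 g₀ os) M Bad W shA shM Wsh δ) ∧
          (∃ (Bad : ℕ → ℝ → Finset (Σ K, SiteSeqKey F (0 + K))) (W Wsh δ : ℕ → ℝ),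
            HybridNE7 1 (F.side ^ 4) (classSet₁₃ θ 0 g₀) M (weightB₁₃ θ hP 0 g₀ os) Bad W shM shB Wsh δ) ∧
          (∃ R : ℕ → ℝ, ∀ K : ℕ, ∃ c : ℝ, ∀ t : ℝ, |t| ≤ 1 → ∀ x ∈ classSet₁₃ θ 0 g₀ K,
            Real.exp (c - F.side ^ 4 * R K) * weightA₁₃ θ hP 0 g₀ os K t x ≤ weightB₁₃ θ hP 0 g₀ os K t x ∧
              weightB₁₃ θ hP 0 g₀ os K t x ≤ Real.exp (c + F.side ^ 4 * R K) * weightA₁₃ θ hP 0 g₀ os K t x))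
    (hlive : ∀ (F : T4Family) (θ : Stage13HParams F 2), θ.Provisos₁₃CoPH F 2 → (θ.ZhUnity F 2 ∧ θ.SlotsNondegenerate₁₃ F 2) → θ.Admissible F 2 →
      LiveSel F θ ∧ ZetaMeasurable F 2 θ.ζ) :
    Summit.QuantumFields.YangMills.Theses.BalabanUVNodes.SpineGivenEndpointR13SepCoPHV :=
  spineGivenEndpointR13SepCoPHV_of_stubRates13HVText_of_keyedHybridNE7_of_liveLine h₁ (keyedHybridNE7_of_keyedLegs hLegs) hlive

/-- ★★★ **THE SMALL-LEGS EDITION OF THE RECORD SOCKET** — the one to use when the two runs' key images DIFFER at early levels (then a class reached by ONE run has weight `0`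
in the other, so no all-terms radius exists; the legs' own bad classes ∕ shells carry such classes).  Per guarded admissible tuple and `(g₀, os)`: SOME intermediate family `M`
with shells `shM`, end shells `shA ∕ shB`, two legs with EXPLICIT bad classes ∕ weights ∕ shell weights ∕ radii satisfying at every level «bad + shell weight `≤ 1∕8`» and
«`2·F.side⁴·δ ≤ log 2`» ⇒ 13U's certificate `hH` (§1 `hybridNE7_trans_of_small`; no zeroing, end shells kept).  The legs are HYPOTHESES. [bookkeeping] -/
theorem keyedHybridNE7_of_keyedSmallLegs
    (hLegs : ∀ (F : T4Family) (θ : Stage13HParams F 2) (hP : θ.Provisos₁₃CoPH F 2), (θ.ZhUnity F 2 ∧ θ.SlotsNondegenerate₁₃ F 2) → θ.Admissible F 2 →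
      ∀ (g₀ : ℕ → ℝ) (os : List (ULoop F)),
        letI : DecidableEq (Σ K, SiteSeqKey F (0 + K)) := Classical.decEq _
        ∃ (M shA shM shB : ℕ → ℝ → (Σ K, SiteSeqKey F (0 + K)) → ℝ)
          (Bad₁ : ℕ → ℝ → Finset (Σ K, SiteSeqKey F (0 + K))) (W₁ Wsh₁ δ₁ : ℕ → ℝ)
          (Bad₂ : ℕ → ℝ → Finset (Σ K, SiteSeqKey F (0 + K))) (W₂ Wsh₂ δ₂ : ℕ → ℝ),
          HybridNE7 1 (F.side ^ 4) (classSet₁₃ θ 0 g₀) (weightA₁₃ θ hP 0 g₀ os) M Bad₁ W₁ shA shM Wsh₁ δ₁ ∧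
          HybridNE7 1 (F.side ^ 4) (classSet₁₃ θ 0 g₀) M (weightB₁₃ θ hP 0 g₀ os) Bad₂ W₂ shM shB Wsh₂ δ₂ ∧
          (∀ K, W₁ K + Wsh₁ K ≤ 1 / 8) ∧ (∀ K, W₂ K + Wsh₂ K ≤ 1 / 8) ∧
          (∀ K, 2 * (F.side ^ 4 * δ₁ K) ≤ Real.log 2) ∧ (∀ K, 2 * (F.side ^ 4 * δ₂ K) ≤ Real.log 2)) :
    ∀ (F : T4Family) (θ : Stage13HParams F 2) (hP : θ.Provisos₁₃CoPH F 2), (θ.ZhUnity F 2 ∧ θ.SlotsNondegenerate₁₃ F 2) → θ.Admissible F 2 →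
      ∀ (g₀ : ℕ → ℝ) (os : List (ULoop F)),
        letI : DecidableEq (Σ K, SiteSeqKey F (0 + K)) := Classical.decEq _
        ∃ (Bad : ℕ → ℝ → Finset (Σ K, SiteSeqKey F (0 + K))) (W : ℕ → ℝ) (shA shB : ℕ → ℝ → (Σ K, SiteSeqKey F (0 + K)) → ℝ) (Wsh δ : ℕ → ℝ),
          HybridNE7 1 (F.side ^ 4) (classSet₁₃ θ 0 g₀) (weightA₁₃ θ hP 0 g₀ os) (weightB₁₃ θ hP 0 g₀ os) Bad W shA shB Wsh δ := by
  intro F θ hP hG hθ g₀ os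
  letI : DecidableEq (Σ K, SiteSeqKey F (0 + K)) := Classical.decEq _
  obtain ⟨M, shA, shM, shB, Bad₁, W₁, Wsh₁, δ₁, Bad₂, W₂, Wsh₂, δ₂, h₁, h₂, hs₁, hs₂, hr₁, hr₂⟩ := hLegs F θ hP hG hθ g₀ os
  exact ⟨_, _, shA, shB, _, _, hybridNE7_trans_of_small h₁ h₂ hs₁ hs₂ hr₁ hr₂⟩

/-- ★★ **K3⁸ v6 STUB 2's TEXT FROM TWO SMALL KEYED LEGS AND THE KEYED LIVE LINE** [bookkeeping] (the small-legs certificate fed to 13U).  NOT a proof of `stub_expansion13HV`: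
the legs and the live line are HYPOTHESES. -/
theorem stubExpansion13HVText_of_keyedSmallLegs_of_liveLine
    (hLegs : ∀ (F : T4Family) (θ : Stage13HParams F 2) (hP : θ.Provisos₁₃CoPH F 2), (θ.ZhUnity F 2 ∧ θ.SlotsNondegenerate₁₃ F 2) → θ.Admissible F 2 →
      ∀ (g₀ : ℕ → ℝ) (os : List (ULoop F)),
        letI : DecidableEq (Σ K, SiteSeqKey F (0 + K)) := Classical.decEq _
        ∃ (M shA shM shB : ℕ → ℝ → (Σ K, SiteSeqKey F (0 + K)) → ℝ)
          (Bad₁ : ℕ → ℝ → Finset (Σ K, SiteSeqKey F (0 + K))) (W₁ Wsh₁ δ₁ : ℕ → ℝ)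
          (Bad₂ : ℕ → ℝ → Finset (Σ K, SiteSeqKey F (0 + K))) (W₂ Wsh₂ δ₂ : ℕ → ℝ),
          HybridNE7 1 (F.side ^ 4) (classSet₁₃ θ 0 g₀) (weightA₁₃ θ hP 0 g₀ os) M Bad₁ W₁ shA shM Wsh₁ δ₁ ∧
          HybridNE7 1 (F.side ^ 4) (classSet₁₃ θ 0 g₀) M (weightB₁₃ θ hP 0 g₀ os) Bad₂ W₂ shM shB Wsh₂ δ₂ ∧
          (∀ K, W₁ K + Wsh₁ K ≤ 1 / 8) ∧ (∀ K, W₂ K + Wsh₂ K ≤ 1 / 8) ∧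
          (∀ K, 2 * (F.side ^ 4 * δ₁ K) ≤ Real.log 2) ∧ (∀ K, 2 * (F.side ^ 4 * δ₂ K) ≤ Real.log 2))
    (hlive : ∀ (F : T4Family) (θ : Stage13HParams F 2), θ.Provisos₁₃CoPH F 2 → (θ.ZhUnity F 2 ∧ θ.SlotsNondegenerate₁₃ F 2) → θ.Admissible F 2 →
      LiveSel F θ ∧ ZetaMeasurable F 2 θ.ζ) :
    ∀ β : ℝ, 2 / 3 < β → β < 1 →
      ∀ (𝔯 : RateReading₁₃CoPH 2) (ksel : RunSel) (ℓ : LetterReading) (ℓ₃ : T4Family → Node00.NE3Letters₁₁) (g B : T4Family → ℝ),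
        GuardedReadingN16 𝔯 ksel ℓ ℓ₃ g B → KeyedRatesHolderD4V β (rrOfRecord 𝔯 ksel) →
        ∃ (jc : CutReading) (sh : ShellSplit₁₃CoPH 2 0) (cr : SpineReading), PinnedAtLive jc sh cr ∧
          KeyedRelWeight cr ∧ KeyedShellWeight cr ∧ KeyedExtractionV cr ∧ KeyedCoreEdgeHolderD4V β cr (rrOfRecord 𝔯 ksel) :=
  stubExpansion13HVText_of_keyedHybridNE7_of_liveLine (keyedHybridNE7_of_keyedSmallLegs hLegs) hlive

end Record

/-! ## §4 K3⁸ by name from legs UNDER THE ITEM's OWN PREFIX — any carriers, any origin, no live line, no K4 [bookkeeping] -/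

section Prefix

open Literature.MathematicalPhysics.QuantumFieldTheory.Balaban1983to89.T4Continuum
open Literature.MathematicalPhysics.QuantumFieldTheory.Balaban1983to89.Node00
open Summit.QuantumFields.YangMills.BalabanUVNodes.N19HybridChainRuleTower (hybridNE7Under_of_legs)

/-- ★★★ **K3⁸ BY NAME FROM TWO LEGS PER STRING UNDER THE ITEM's OWN PREFIX** [bookkeeping].  `SpineGivenEndpointR13SepCoPHV` IS (`K3V6Defs.spineGivenEndpointR13SepCoPHV_iff`,
`Iff.rfl`) «per guarded admissible slot tuple, (B) → END → `T4ApexHybrid.HybridNE7Under (datumOfRecord₁₃SepCoPHV F 2 θ h v) END`», and binder B5 there is the per-string package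
with the origin EXISTENTIAL (dag-n27-a's `hybridNE7Under_iff_spineNodes_tail`).  So: if at every guarded admissible slot tuple, UNDER `(B) → END → ForSmallCouplings`, every
string `os` of the slot datum's scheme has SOME carriers from SOME origin `K₀` with `0 < l₀`, `0 < vol`, the two runs' E1∕E2 dictionary for families `A ∕ B`, and SOME
intermediate family `M` with two hybrid legs `A → M → B` (each for some bad classes ∕ weights ∕ shell weight ∕ radius, middle shell shared), then K3⁸ — FILE 2 §7
`hybridNE7Under_of_legs` per slot tuple.  NO origin-`0` pin, NO all-terms radius, NO smallness binder, NO live line, NO K4, NO stub text: the item asks less than v6's stub 2.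
NOT a proof of K3⁸: the legs (the two-run content, NOT PRINTED for d = 4) and the dictionary are HYPOTHESES inhabited for no tuple (K0⁷ OPEN). -/
theorem spineGivenEndpointR13SepCoPHV_of_legsUnderPrefix
    (hLegs : ∀ (F : T4Family) (θ : Stage13HParams F 2) (h : θ.Provisos₁₃SepCoPH F 2) (v : Revision₁₃ F 2 θ h),
      (θ.ZhUnity F 2 ∧ θ.SlotsNondegenerate₁₃ F 2) → θ.Admissible F 2 →
      (datumOfRecord₁₃SepCoPHV F 2 θ h v).UnderHypotheses (DagBinding.EndpointExistence (datumOfRecord₁₃SepCoPHV F 2 θ h v).C.toB12) fun g₀ =>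
        ∀ os : List (ULoop F),
          ∃ (ι : Type) (_ : DecidableEq ι) (l₀ vol : ℝ) (K₀ : ℕ) (T : ℕ → Finset ι) (A M B shA shM shB : ℕ → ℝ → ι → ℝ),
            0 < l₀ ∧ 0 < vol ∧
              (∃ (Bad : ℕ → ℝ → Finset ι) (W Wsh δ : ℕ → ℝ), HybridNE7 l₀ vol T A M Bad W shA shM Wsh δ) ∧
              (∃ (Bad : ℕ → ℝ → Finset ι) (W Wsh δ : ℕ → ℝ), HybridNE7 l₀ vol T M B Bad W shM shB Wsh δ) ∧
              (∀ (K : ℕ) (t : ℝ), |t| ≤ l₀ →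
                T4GenFunBounds.schemeZ ((datumOfRecord₁₃SepCoPHV F 2 θ h v).scheme g₀) os (K₀ + K) t = ∑ τ ∈ T K, A K t τ) ∧
              (∀ (K : ℕ) (t : ℝ), |t| ≤ l₀ →
                T4GenFunBounds.schemeZ ((datumOfRecord₁₃SepCoPHV F 2 θ h v).scheme g₀) os (K₀ + K + 1) t = ∑ τ ∈ T K, B K t τ)) :
    Summit.QuantumFields.YangMills.Theses.BalabanUVNodes.SpineGivenEndpointR13SepCoPHV :=
  fun F θ h v hG hA _ _ => hybridNE7Under_of_legs _ (hLegs F θ h v hG hA)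

end Prefix

end Summit.QuantumFields.YangMills.BalabanUVNodes.N19HybridChainRuleAtOrigin

end
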